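import Literature.MathematicalPhysics.QuantumFieldTheory.Balaban1983to89.B9Eq349ConjugatedGreenBlockDecay
import Literature.MathematicalPhysics.QuantumFieldTheory.Balaban1983to89.B9Eq316TowerFlatIsOneStep

/-!
# `Balaban1983to89.B9Eq349PointDecayFromCircle` — T. Bałaban, *Propagators for lattice gauge theories in a background field*, Commun. Math. Phys.
# **99** (1985) 389–434 [Balaban1985BackgroundPropagators] (3.49) p. 399 with Thm 3.11 p. 416: **POINT DECAY ON THE UNIT LATTICE `T_m` FROM A
# COMBES–THOMAS CIRCLE LETTER UNIFORM OVER ONE PAIR's WEIGHTS, THE FINE WEIGHT LIVING ON `T_{Nm}`** — for an operator `c` on `L²(T_m)` (weight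
# `c₁`), the point family `r_y` ((K1)'s letters at `π = id`) and ONE bound `C` on `‖e^{κM_{χ′}} c e^{−κM_{χ′}}‖` for every `‖κ‖ = ρ` and every pair
# of weights (`χ` on the fine torus with bond increments `≤ ι`, `1∕N ≤ ι`; `χ′` on `T_m` reading `χ` on the blocks within `ℓ′ ≥ 1`):
# `‖r_{y₁} ∘ c ∘ r_{y₀}‖ ≤ C·e^{ρ}·e^{−ρ·d_m(y₀,y₁)}`, on the typing `fineP N m` and on ANY typing `P = fineP N m` (`subst`) — the unit-lattice twin of
# ne9-leaf-01's `B9Eq349ConjugatedGreenBlockDecay.norm_block_le_exp_of_uniform_circle_bound_sites`, the read-out of the `K̃`-row at `k` levels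
# (`B9Eq349ConjugatedQGGQInvBlockDecayTower`); route R2′ road B8″

statement-level skeleton of published theorems with citation tags; proofs where landed; nothing here is a claim about the Yang–Mills mass gap

CITATION HEADER (lean-in-tree rule).  Audit cell `pub-balaban`, sub-cell `t4`, BINDER row NE9; filed by NE9 formalisation-swarm LEAF PROVER 03
(`b2b-balaban-t4-ne9-formalise-leaf-03`, gen 74), composing BY NAME ne9-leaf-01's chain: (K2) `B9Eq349BlockDistanceWeight.exists_pairWeight` (the pair
weight at block size `N`, read here at the block CENTRES `χ′ := χ ∘ centre`), (K1) `B9Eq349BlockMultipliers` (`mul_comp_block_eq_smul`,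
`block_comp_mul_eq_smul`, `opNorm_block_le` at `π = id`), (A) §2 `B9Eq3101CommutatorCauchyBlockDecay.norm_block_le_of_conj_bound_abs`, (D)
`B9Eq387IMSLocalLettersLattice.exists_pointwise_clm`, `B9Eq316TowerFlatIsOneStep.siteCast`.  Source READ in the held text [Balaban1985BackgroundPropagators]:
p. 399 (3.49) (kernels with `exp(−δ₀d(y,y′))` — print's random-walk route; the conjugation is the ROUTE's Combes–Thomas substitute, [folklore]); p. 416
Thm 3.11; [Balaban1985Averaging] (2) p. 17 (blocks and centres).  NOTHING of print's rate is asserted.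

WHAT IS PROVED (sorry-free; proof lane — no `def`; [folklore]).
* **`norm_point_le_exp_of_uniform_circle_bound`** (fine torus typed `fineP N m`) and **`norm_point_le_exp_of_uniform_circle_bound_cast`** (`h : P = fineP N m`,
  blocks by `blockCoord N m (siteCast h x) = y`).
HONEST SCOPE.  Plumbing; no operator of [B9] occurs; ONE read-out device, NOT NE9 (cell pub-balaban: NE9 NOT PRINTED ∕ NOT PROVED; «NE9 ⇐ the named
binders»; row WALLED ON A MODEL (O-NE9-1; #5 UNRULED); spine PROVED 0∕9; rung (B)+1 on a finite T⁴ — NOT infinite volume, NOT mass gap, NOT BetaPertH, NOT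
Clay; HONEST DEPENDENCY: continuum YM on T⁴ ⇐ BetaPertH ∧ nine spine estimates (0/9 proved); BetaPertH ⇐ (D1) ∧ (D4) ∧ CAP+tail; G-an2-4 gates asym, D1
and NE2/3/4).  NEW file importing the BUILT `B9Eq349ConjugatedGreenBlockDecay` and `B9Eq316TowerFlatIsOneStep`; nothing modified.  Net new unproved facts: 0.
-/

noncomputable section

set_option autoImplicit false

open scoped InnerProductSpace ComplexConjugate BigOperators
open NormedSpace

namespace Literature.MathematicalPhysics.QuantumFieldTheory.Balaban1983to89.B9Eq349PointDecayFromCircle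

open B4Sect5Torus (TSite tdist)
open B9SectCLatticeCarrier (Bond bpos btgt)
open B9Eq311L2Pairing (WL2)
open B9Eq319QprimeTorus (fineP blockCoord mem_blockOf_iff centre blockCoord_centre)
open B9Eq316TowerFlatIsOneStep (siteCast siteCast_rfl)
open B11Eq103H1Complex (SiteL2K)

/-! ## Point decay on the unit lattice from a circle letter uniform over the fine ∕ coarse weights of ONE pair -/

section Points

variable {d : ℕ} {m : Fin d → ℕ} {c₁ : ℝ} [Fact (0 < c₁)]
  {W : Type*} [NormedAddCommGroup W] [InnerProductSpace ℂ W] [FiniteDimensional ℂ W]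

/-- **POINT DECAY ON `T_m` FROM A UNIFORM CIRCLE LETTER, THE FINE WEIGHT LIVING ON `T_{Nm}`**: `c : L²(T_m) → L²(T_m)`, the point family `r_y` ((K1)'s letters
at `π = id`), and ONE bound `C` on `‖e^{κM_{χ′}} ∘ c ∘ e^{−κM_{χ′}}‖` for every `‖κ‖ = ρ` and every pair of weights (`χ` on the fine torus with bond
increments `≤ ι`, `1∕N ≤ ι`; `χ′` on `T_m` reading `χ` on the blocks within `ℓ′ ≥ 1`) ⟹ `‖r_{y₁} ∘ c ∘ r_{y₀}‖ ≤ C·e^{ρ}·e^{−ρ·d_m(y₀,y₁)}` — (K2)'s pair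
weight at block size `N` read at the block CENTRES (`χ′ := χ ∘ centre`), (K1)'s eigen-relations at the two points, (A) §2 `norm_block_le_of_conj_bound_abs`.
[folklore] (Combes–Thomas ∕ Agmon) [cite: Balaban1985BackgroundPropagators, (3.49) p.399, Thm 3.11 p.416; Balaban1985Averaging, (2) p.17] -/
theorem norm_point_le_exp_of_uniform_circle_bound {N : ℕ} [NeZero N] (hm : ∀ i, 1 ≤ m i)
    (c : SiteL2K ℂ d m c₁ W →L[ℂ] SiteL2K ℂ d m c₁ W)
    {r : TSite d m → SiteL2K ℂ d m c₁ W →L[ℂ] SiteL2K ℂ d m c₁ W}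
    (hr : ∀ (y : TSite d m) (g : SiteL2K ℂ d m c₁ W) (y' : TSite d m),
      WL2.equiv ℂ (fun _ : TSite d m => c₁) W (r y g) y' = if y' = y then WL2.equiv ℂ (fun _ : TSite d m => c₁) W g y' else 0)
    {ρ C ι ℓ' : ℝ} (hρ : 0 ≤ ρ) (hC0 : 0 ≤ C) (hι : 1 / (N : ℝ) ≤ ι) (hℓ' : 1 ≤ ℓ')
    (hC : ∀ (χ : TSite d (fineP N m) → ℝ) (χ' : TSite d m → ℝ),
      (∀ b : Bond d (fineP N m), |χ (bpos b) - χ (btgt b)| ≤ ι) →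
      (∀ (y : TSite d m), ∀ x ∈ B9Eq319QprimeTorus.blockOf N m y, |χ' y - χ x| ≤ ℓ') →
      ∀ (MS' : SiteL2K ℂ d m c₁ W →L[ℂ] SiteL2K ℂ d m c₁ W),
      (∀ (g : SiteL2K ℂ d m c₁ W) (y : TSite d m),
        WL2.equiv ℂ (fun _ : TSite d m => c₁) W (MS' g) y = (χ' y : ℂ) • WL2.equiv ℂ (fun _ : TSite d m => c₁) W g y) →
      ∀ κ : ℂ, ‖κ‖ = ρ → ‖exp (κ • MS') ∘L c ∘L exp (κ • (-MS'))‖ ≤ C)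
    (y₀ y₁ : TSite d m) :
    ‖r y₁ ∘L c ∘L r y₀‖ ≤ C * Real.exp ρ * Real.exp (-(ρ * tdist m y₀ y₁)) := by
  classical
  obtain ⟨χ, -, hχA, hχB, hχbond, -, hχcentre, hDlo, -⟩ := B9Eq349BlockDistanceWeight.exists_pairWeight (L := N) hm y₀ y₁
  set D : ℝ := max 0 ((N : ℝ) * tdist m y₀ y₁ - ((N : ℝ) - 1)) with hD
  obtain ⟨MS', hMS'⟩ := B9Eq387IMSLocalLettersLattice.exists_pointwise_clm (𝕜 := ℂ) (w := fun _ : TSite d m => c₁) (V := W)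
    (fun y : TSite d m => y) (fun y => χ (centre N m y))
  have hCχ := hC χ (fun y => χ (centre N m y)) (fun b => (hχbond b).trans hι) (fun y x hx => (hχcentre y x hx).trans hℓ') MS' hMS'
  have hκp : ‖((ρ : ℝ) : ℂ)‖ = ρ := by rw [Complex.norm_real, Real.norm_eq_abs, abs_of_nonneg hρ]
  have hκm : ‖((-ρ : ℝ) : ℂ)‖ = ρ := by rw [Complex.norm_real, Real.norm_eq_abs, abs_neg, abs_of_nonneg hρ]
  have hA : χ (centre N m y₀) = 0 := hχA _ (blockCoord_centre N m y₀)
  have hB : χ (centre N m y₁) = D / N := hχB _ (blockCoord_centre N m y₁)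
  have hp : MS' ∘L r y₀ = (((0 : ℝ) : ℂ)) • r y₀ :=
    B9Eq349BlockMultipliers.mul_comp_block_eq_smul (π := fun y : TSite d m => y) hr hMS' y₀ _ fun x hx => by rw [hx, hA]; simp
  have hq : r y₁ ∘L MS' = (((D / N : ℝ)) : ℂ) • r y₁ :=
    B9Eq349BlockMultipliers.block_comp_mul_eq_smul (π := fun y : TSite d m => y) hr hMS' y₁ _ fun x hx => by rw [hx, hB]; rfl
  have h := B9Eq3101CommutatorCauchyBlockDecay.norm_block_le_of_conj_bound_abs MS' MS' c (r y₀) (r y₁) 0 (D / N) ρ hp hq (hCχ _ hκp) (hCχ _ hκm)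
  have hDL : 0 ≤ D / N := div_nonneg (le_max_left _ _) (Nat.cast_nonneg _)
  rw [sub_zero, abs_of_nonneg hDL] at h
  have h1 : ‖r y₁ ∘L c ∘L r y₀‖ ≤ Real.exp (-(ρ * (D / N))) * C := by
    refine h.trans (mul_le_mul_of_nonneg_left ?_ (Real.exp_pos _).le)
    calc ‖r y₁‖ * C * ‖r y₀‖ ≤ 1 * C * 1 := by
          gcongr
          · exact B9Eq349BlockMultipliers.opNorm_block_le hr y₁
          · exact B9Eq349BlockMultipliers.opNorm_block_le hr y₀
      _ = C := by ring
  refine h1.trans ?_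
  rw [mul_comm, mul_assoc, ← Real.exp_add]
  refine mul_le_mul_of_nonneg_left (Real.exp_le_exp.mpr ?_) hC0
  nlinarith

/-- **… ON ANY TYPING `P = fineP N m` OF THE FINE TORUS** (`h`, e.g. `towerP_eq_fineP_pow`): the same with the fine weight on `TSite d P` and the block
reading through `blockCoord N m (siteCast h x) = y` — by `subst`. [folklore] [cite: Balaban1985BackgroundPropagators, (3.49) p.399; Balaban1985Averaging, (2) p.17] -/
theorem norm_point_le_exp_of_uniform_circle_bound_cast {P : Fin d → ℕ} {N : ℕ} [NeZero N] (h : P = fineP N m) (hm : ∀ i, 1 ≤ m i)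
    (c : SiteL2K ℂ d m c₁ W →L[ℂ] SiteL2K ℂ d m c₁ W)
    {r : TSite d m → SiteL2K ℂ d m c₁ W →L[ℂ] SiteL2K ℂ d m c₁ W}
    (hr : ∀ (y : TSite d m) (g : SiteL2K ℂ d m c₁ W) (y' : TSite d m),
      WL2.equiv ℂ (fun _ : TSite d m => c₁) W (r y g) y' = if y' = y then WL2.equiv ℂ (fun _ : TSite d m => c₁) W g y' else 0)
    {ρ C ι ℓ' : ℝ} (hρ : 0 ≤ ρ) (hC0 : 0 ≤ C) (hι : 1 / (N : ℝ) ≤ ι) (hℓ' : 1 ≤ ℓ')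
    (hC : ∀ (χ : TSite d P → ℝ) (χ' : TSite d m → ℝ),
      (∀ b : Bond d P, |χ (bpos b) - χ (btgt b)| ≤ ι) →
      (∀ (y : TSite d m) (x : TSite d P), blockCoord N m (siteCast h x) = y → |χ' y - χ x| ≤ ℓ') →
      ∀ (MS' : SiteL2K ℂ d m c₁ W →L[ℂ] SiteL2K ℂ d m c₁ W),
      (∀ (g : SiteL2K ℂ d m c₁ W) (y : TSite d m),
        WL2.equiv ℂ (fun _ : TSite d m => c₁) W (MS' g) y = (χ' y : ℂ) • WL2.equiv ℂ (fun _ : TSite d m => c₁) W g y) →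
      ∀ κ : ℂ, ‖κ‖ = ρ → ‖exp (κ • MS') ∘L c ∘L exp (κ • (-MS'))‖ ≤ C)
    (y₀ y₁ : TSite d m) :
    ‖r y₁ ∘L c ∘L r y₀‖ ≤ C * Real.exp ρ * Real.exp (-(ρ * tdist m y₀ y₁)) := by
  subst h
  simp only [siteCast_rfl, Equiv.refl_apply] at hC
  exact norm_point_le_exp_of_uniform_circle_bound hm c hr hρ hC0 hι hℓ'
    (fun χ χ' hχ hχ' MS' hMS' κ hκ => hC χ χ' hχ (fun y x hx => hχ' y x ((mem_blockOf_iff N m y x).2 hx)) MS' hMS' κ hκ) y₀ y₁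

end Points

end Literature.MathematicalPhysics.QuantumFieldTheory.Balaban1983to89.B9Eq349PointDecayFromCircle

end
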